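import Mathlib
import HarnessLib
import Literature.MathematicalPhysics.AQFT.OSAxiomsSchwinger
import Literature.MathematicalPhysics.QuantumLattice.SchwartzTensor
import Literature.MathematicalPhysics.QuantumLattice.SchwartzTensorDensity
import Literature.MathematicalPhysics.QuantumLattice.RandomField

/-!
# Closure helper for line `Sketch` (coupling response) of crux `HypercubicLimit`: real product tensors with
# pairwise disjoint supports lie in `⁰𝒮`, every arity

Sub-goal `isOffDiagonal_of_pairwise_disjoint` (stmt-QuantumFields-16154, registered skeleton
`Cruxes/HypercubicLimit/Lines/Sketch.lean`).  The crux's convergence clause and the line's `k`-uniform moment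
bounds are stated on real product tensors `F = f₁ ⊗ ⋯ ⊗ fₙ` (complexified factors `ofRealTest (f i)`); the
closure step needs that such a tensor whose factors have PAIRWISE DISJOINT closed supports `tsupport (f i)` is an
Osterwalder–Schrader test function flat on the diagonals (`IsOffDiagonal F`, `F ∈ ⁰𝒮`) for EVERY arity `n`.
Proof: `tsupport F ⊆ {x | ∀ i, x i ∈ tsupport (ofRealTest (f i))} ⊆ {x | ∀ i, x i ∈ tsupport (f i)}`
(`IsTensorOf.tsupport_subset`, `tsupport_comp_subset`), and a point of that set with `x i = x j`, `i ≠ j`,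
would put `x i` in both `tsupport (f i)` and `tsupport (f j)`; so `tsupport F` avoids the coincidence locus and
`IsOffDiagonal.of_tsupport_subset` applies (all derivatives vanish off `tsupport F`).
-/

noncomputable section

open scoped SchwartzMap
open Filter Topology
open Literature.MathematicalPhysics.AQFT Literature.MathematicalPhysics.QuantumLattice

namespace Summit.QuantumFields.YangMills.Cruxes.HypercubicLimit.CouplingResponse

-- adapted from `Summit.QuantumFields.YangMills.Theorems.OSLegsFromFemtoAndGap.isOffDiagonal_of_disjoint_three`
-- (Theorems/LangevinControlUVOSLegsFromFemtoAndGapStubAssemblyNontrivial.lean, arity 3): same support criterion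
-- `IsOffDiagonal.of_tsupport_subset`, with the closed box `{x | ∀ i, x i ∈ tsupport (f i)}` supplied for every
-- arity by `IsTensorOf.tsupport_subset` (SchwartzTensorDensity) instead of the hand-built three-factor box.
/-- **Closure helper (`⁰𝒮`-membership of disjoint product tensors).**  A real product tensor
`F = f₁ ⊗ ⋯ ⊗ fₙ` (factors complexified by `ofRealTest`) whose factors have pairwise disjoint topological
supports lies in `⁰𝒮`: all iterated Fréchet derivatives of `F` vanish on the coincidence locus
`{x | ∃ i ≠ j, x i = x j}`, because `tsupport F ⊆ {x | ∀ i, x i ∈ tsupport (f i)}` cannot meet it. [folklore] -/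
theorem isOffDiagonal_of_pairwise_disjoint : ∀ (n : ℕ) (f : Fin n → 𝓢(EuclideanSpace ℝ (Fin 4), ℝ)) (F : 𝓢((Fin n → EuclideanSpace ℝ (Fin 4)), ℂ)), IsTensorOf F (fun i => ofRealTest (f i)) → (∀ i j, i ≠ j → Disjoint (tsupport (f i)) (tsupport (f j))) → IsOffDiagonal F := by
  intro n f F hF hdisj
  refine IsOffDiagonal.of_tsupport_subset fun x hx hxc => ?_
  obtain ⟨i, j, hij, hxij⟩ := hxc
  -- `tsupport (ofRealTest (f l)) ⊆ tsupport (f l)` since `(0 : ℝ) ↦ (0 : ℂ)`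
  have hsub : ∀ l : Fin n, tsupport (ofRealTest (f l) : EuclideanSpace ℝ (Fin 4) → ℂ) ⊆
      tsupport (f l : EuclideanSpace ℝ (Fin 4) → ℝ) := fun l =>
    tsupport_comp_subset (g := fun t : ℝ => (t : ℂ)) Complex.ofReal_zero _
  have hi : x i ∈ tsupport (f i : EuclideanSpace ℝ (Fin 4) → ℝ) := hsub i (hF.tsupport_subset hx i)
  have hj : x j ∈ tsupport (f j : EuclideanSpace ℝ (Fin 4) → ℝ) := hsub j (hF.tsupport_subset hx j)
  exact (hdisj i j hij).ne_of_mem hi hj hxij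

end Summit.QuantumFields.YangMills.Cruxes.HypercubicLimit.CouplingResponse

end
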